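import Mathlib
import HarnessLib
import Summits.ValiantsHypothesis.ValiantsHypothesis.Theorems.LacunarySymmetroidMatrixDescartesOsculationCommutingDiagonal
import Summits.ValiantsHypothesis.ValiantsHypothesis.Theorems.LacunarySymmetroidMatrixDescartesOsculationCommutingTop
import Summits.ValiantsHypothesis.ValiantsHypothesis.Theorems.LacunarySymmetroidMatrixDescartesOsculationLawUniformCongruence

/-!
# ValiantsHypothesis / LacunarySymmetroid — crux `MatrixDescartes` (stmt-ValiantsHypothesis-18050, V1),
# line `Cruxes/MatrixDescartes/Lines/osculation_law.lean` («osculation-law»): the COMMUTING-PENCIL OSCULATION LAW at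
# EVERY splitting — letters commuting pairwise AND with the inserted letter `I_r ⊕ 0` (O1 MATRIX layer, part 4)

The honest all-splittings form of «commuting pencil INCLUDING the inserted letter»: if the symmetric letters `S_l` on
`Fin r ⊕ Fin s` commute pairwise and each commutes with the block projector `P = I_r ⊕ 0`, then every `S_l` is block
diagonal (`eq_fromBlocks_of_commute_proj`), the two commuting symmetric block families are simultaneously orthogonally
diagonalised (`OsculationCommuting.exists_orthogonal_forall_isDiag`, part 3) by `U = U₁ ⊕ U₂`, which commutes with `P`;
the congruence `S_l = U D_l Uᵀ`, `P = U P Uᵀ`, `(det U)² = 1` makes the line's insertion polynomial LITERALLY that of the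
DIAGONAL pencil `D` (`det_pencil_congr_orthogonal`, via `OsculationUniform.mvPencil_congr`), and part 2's `osc_diagonal_le`
counts:

* `osculationLawAt_commuting (m K) : ∀ r s, r + s = m → ∀ d S, (∀ l, (S l).IsSymm) → (∀ l l', Commute (S l) (S l')) →
  (∀ l, Commute (S l) (Matrix.fromBlocks 1 0 0 0)) → (osculationSet d S).Finite → ncard ≤ m·K² + m²·K` — the LAW's body
  (`OsculationLawAt m K (m·K² + m²·K)` unfolded verbatim) with TWO hypotheses inserted after the symmetry hypothesis.  It
  contains (A) `osculationLawAt_diagonal` (diagonal letters commute with everything diagonal) and (B)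
  `osculationLawAt_commuting_top` (at `s = 0` the projector is `1`) of the roster file `…OsculationCommuting.lean`.

Without the second hypothesis the statement changes character for `s ≥ 1` (pairwise-commuting letters in
`span{I, [[0,1],[1,0]]}`, `m = 2`, `r = s = 1`: `Φ = α² + bα − β²` is one non-split sheet) — that regime is the LAW's, not
this rung's.  HONEST LABEL: restricted class (polynomial); NOT `stub_osculationLaw`, not `MatrixDescartes` (stmt-18050), not
Conjecture B; `VP ≠ VNP` is NOT proved.  No definitions, no named facts; Mathlib + tree files by name.
-/

-- `Summit.ValiantsHypothesis.ValiantsHypothesis.…` is the tree's mandated single-conjunct layout (Sub = Summit).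
set_option linter.dupNamespace false

noncomputable section

namespace Summit.ValiantsHypothesis.ValiantsHypothesis.Theorems.LacunarySymmetroidMatrixDescartes

namespace OsculationCommuting

open Polynomial
open scoped BigOperators Matrix

/-! ### Block structure forced by commuting with the projector -/

/-- A matrix commuting with `I_r ⊕ 0` is block diagonal. [folklore] -/
theorem eq_fromBlocks_of_commute_proj {r s : ℕ} (A : Matrix (Fin r ⊕ Fin s) (Fin r ⊕ Fin s) ℝ)
    (h : Commute A (Matrix.fromBlocks 1 0 0 0)) :
    A = Matrix.fromBlocks A.toBlocks₁₁ 0 0 A.toBlocks₂₂ := by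
  have hA := (Matrix.fromBlocks_toBlocks A).symm
  have h' := h.eq
  rw [hA, Matrix.fromBlocks_multiply, Matrix.fromBlocks_multiply] at h'
  simp only [Matrix.mul_one, Matrix.mul_zero, Matrix.one_mul, Matrix.zero_mul, add_zero] at h'
  obtain ⟨-, h12, h21, -⟩ := Matrix.fromBlocks_inj.1 h'
  conv_lhs => rw [hA, ← h12, h21]

/-- Blocks of a symmetric matrix are symmetric (diagonal blocks). [folklore] -/
theorem isSymm_toBlocks {r s : ℕ} {A : Matrix (Fin r ⊕ Fin s) (Fin r ⊕ Fin s) ℝ} (h : A.IsSymm) :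
    A.toBlocks₁₁.IsSymm ∧ A.toBlocks₂₂.IsSymm := by
  constructor
  · ext i j
    simp only [Matrix.transpose_apply, Matrix.toBlocks₁₁, Matrix.of_apply]
    exact h.apply _ _
  · ext i j
    simp only [Matrix.transpose_apply, Matrix.toBlocks₂₂, Matrix.of_apply]
    exact h.apply _ _

/-- Block-diagonal matrices multiply blockwise; so commuting block-diagonal matrices have commuting blocks. [folklore] -/
theorem toBlocks_commute {r s : ℕ} {A B : Matrix (Fin r ⊕ Fin s) (Fin r ⊕ Fin s) ℝ}
    (hA : A = Matrix.fromBlocks A.toBlocks₁₁ 0 0 A.toBlocks₂₂) (hB : B = Matrix.fromBlocks B.toBlocks₁₁ 0 0 B.toBlocks₂₂)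
    (h : A * B = B * A) :
    A.toBlocks₁₁ * B.toBlocks₁₁ = B.toBlocks₁₁ * A.toBlocks₁₁ ∧ A.toBlocks₂₂ * B.toBlocks₂₂ = B.toBlocks₂₂ * A.toBlocks₂₂ := by
  rw [hA, hB, Matrix.fromBlocks_multiply, Matrix.fromBlocks_multiply] at h
  simp only [Matrix.mul_zero, Matrix.zero_mul, add_zero, zero_add] at h
  obtain ⟨h11, -, -, h22⟩ := Matrix.fromBlocks_inj.1 h
  exact ⟨h11, h22⟩

/-! ### Simultaneous orthogonal diagonalisation compatible with the projector -/

/-- For symmetric letters commuting pairwise and with `I_r ⊕ 0` there is an orthogonal `U` with `Uᵀ P U = P` and every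
`Uᵀ S_l U` diagonal. [folklore] -/
theorem exists_orthogonal_proj_forall_isDiag {r s K : ℕ} (S : Fin K → Matrix (Fin r ⊕ Fin s) (Fin r ⊕ Fin s) ℝ)
    (hS : ∀ l, (S l).IsSymm) (hcomm : ∀ k l, S k * S l = S l * S k)
    (hP : ∀ l, Commute (S l) (Matrix.fromBlocks 1 0 0 0)) :
    ∃ U : Matrix (Fin r ⊕ Fin s) (Fin r ⊕ Fin s) ℝ, Uᵀ * U = 1 ∧ U * Uᵀ = 1 ∧
      Uᵀ * Matrix.fromBlocks 1 0 0 0 * U = Matrix.fromBlocks 1 0 0 0 ∧ ∀ l, (Uᵀ * S l * U).IsDiag := by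
  have hblk : ∀ l, S l = Matrix.fromBlocks (S l).toBlocks₁₁ 0 0 (S l).toBlocks₂₂ :=
    fun l => eq_fromBlocks_of_commute_proj (S l) (hP l)
  obtain ⟨U₁, hU₁, hU₁', hD₁⟩ := exists_orthogonal_forall_isDiag (fun l => (S l).toBlocks₁₁)
    (fun l => (isSymm_toBlocks (hS l)).1) (fun k l => (toBlocks_commute (hblk k) (hblk l) (hcomm k l)).1)
  obtain ⟨U₂, hU₂, hU₂', hD₂⟩ := exists_orthogonal_forall_isDiag (fun l => (S l).toBlocks₂₂)
    (fun l => (isSymm_toBlocks (hS l)).2) (fun k l => (toBlocks_commute (hblk k) (hblk l) (hcomm k l)).2)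
  refine ⟨Matrix.fromBlocks U₁ 0 0 U₂, ?_, ?_, ?_, fun l => ?_⟩
  · rw [Matrix.fromBlocks_transpose, Matrix.fromBlocks_multiply]
    simp only [Matrix.transpose_zero, Matrix.mul_zero, Matrix.zero_mul, add_zero, zero_add, hU₁, hU₂,
      Matrix.fromBlocks_one]
  · rw [Matrix.fromBlocks_transpose, Matrix.fromBlocks_multiply]
    simp only [Matrix.transpose_zero, Matrix.mul_zero, Matrix.zero_mul, add_zero, zero_add, hU₁', hU₂',
      Matrix.fromBlocks_one]
  · rw [Matrix.fromBlocks_transpose, Matrix.fromBlocks_multiply, Matrix.fromBlocks_multiply]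
    simp only [Matrix.transpose_zero, Matrix.mul_zero, Matrix.zero_mul, add_zero, Matrix.mul_one, hU₁]
  · rw [hblk l, Matrix.fromBlocks_transpose, Matrix.fromBlocks_multiply, Matrix.fromBlocks_multiply]
    simp only [Matrix.transpose_zero, Matrix.mul_zero, Matrix.zero_mul, add_zero, zero_add]
    exact (hD₁ l).fromBlocks (hD₂ l)

/-! ### The insertion polynomial is a congruence invariant for orthogonal `U` commuting with the projector -/

/-- `det(Σ X₀^{d l} • S_l + X₁ • P) = det(Σ X₀^{d l} • D_l + X₁ • P)` when `D_l = Uᵀ S_l U`, `Uᵀ U = U Uᵀ = 1`,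
`Uᵀ P U = P`. [folklore] -/
theorem det_pencil_congr_orthogonal {r s K : ℕ} (d : Fin K → ℕ) (S D : Fin K → Matrix (Fin r ⊕ Fin s) (Fin r ⊕ Fin s) ℝ)
    (U : Matrix (Fin r ⊕ Fin s) (Fin r ⊕ Fin s) ℝ) (hU : Uᵀ * U = 1) (hU' : U * Uᵀ = 1)
    (hUP : Uᵀ * Matrix.fromBlocks 1 0 0 0 * U = Matrix.fromBlocks 1 0 0 0) (hD : ∀ l, D l = Uᵀ * S l * U) :
    (∑ l, (MvPolynomial.X (0 : Fin 2) : MvPolynomial (Fin 2) ℝ) ^ d l •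
              (S l).map (MvPolynomial.C : ℝ →+* MvPolynomial (Fin 2) ℝ)
            + (MvPolynomial.X (1 : Fin 2) : MvPolynomial (Fin 2) ℝ) •
              (Matrix.fromBlocks 1 0 0 0 : Matrix (Fin r ⊕ Fin s) (Fin r ⊕ Fin s) ℝ).map
                (MvPolynomial.C : ℝ →+* MvPolynomial (Fin 2) ℝ)).det = (∑ l, (MvPolynomial.X (0 : Fin 2) : MvPolynomial (Fin 2) ℝ) ^ d l •
              (D l).map (MvPolynomial.C : ℝ →+* MvPolynomial (Fin 2) ℝ)
            + (MvPolynomial.X (1 : Fin 2) : MvPolynomial (Fin 2) ℝ) •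
              (Matrix.fromBlocks 1 0 0 0 : Matrix (Fin r ⊕ Fin s) (Fin r ⊕ Fin s) ℝ).map
                (MvPolynomial.C : ℝ →+* MvPolynomial (Fin 2) ℝ)).det := by
  -- `S_l = (Uᵀ)ᵀ D_l Uᵀ` and `P = (Uᵀ)ᵀ P Uᵀ`
  have hS : ∀ l, S l = (Uᵀ)ᵀ * D l * Uᵀ := by
    intro l
    rw [Matrix.transpose_transpose, hD, ← Matrix.mul_assoc, ← Matrix.mul_assoc, hU', Matrix.one_mul,
      Matrix.mul_assoc, hU', Matrix.mul_one]
  have hPc : (Matrix.fromBlocks 1 0 0 0 : Matrix (Fin r ⊕ Fin s) (Fin r ⊕ Fin s) ℝ) =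
      (Uᵀ)ᵀ * Matrix.fromBlocks 1 0 0 0 * Uᵀ := by
    rw [Matrix.transpose_transpose]
    calc (Matrix.fromBlocks 1 0 0 0 : Matrix (Fin r ⊕ Fin s) (Fin r ⊕ Fin s) ℝ)
        = (U * Uᵀ) * Matrix.fromBlocks 1 0 0 0 * (U * Uᵀ) := by rw [hU', Matrix.one_mul, Matrix.mul_one]
      _ = U * (Uᵀ * Matrix.fromBlocks 1 0 0 0 * U) * Uᵀ := by simp only [Matrix.mul_assoc]
      _ = U * Matrix.fromBlocks 1 0 0 0 * Uᵀ := by rw [hUP]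
  have hsum : (∑ l, (MvPolynomial.X (0 : Fin 2) : MvPolynomial (Fin 2) ℝ) ^ d l •
              (S l).map (MvPolynomial.C : ℝ →+* MvPolynomial (Fin 2) ℝ)) =
      (Uᵀ.map (MvPolynomial.C : ℝ →+* MvPolynomial (Fin 2) ℝ))ᵀ *
        (∑ l, (MvPolynomial.X (0 : Fin 2) : MvPolynomial (Fin 2) ℝ) ^ d l •
          (D l).map (MvPolynomial.C : ℝ →+* MvPolynomial (Fin 2) ℝ)) *
        Uᵀ.map (MvPolynomial.C : ℝ →+* MvPolynomial (Fin 2) ℝ) := by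
    rw [← OsculationUniform.mvPencil_congr]
    exact Finset.sum_congr rfl fun l _ => by rw [← hS l]
  have hproj : (MvPolynomial.X (1 : Fin 2) : MvPolynomial (Fin 2) ℝ) •
              (Matrix.fromBlocks 1 0 0 0 : Matrix (Fin r ⊕ Fin s) (Fin r ⊕ Fin s) ℝ).map
                (MvPolynomial.C : ℝ →+* MvPolynomial (Fin 2) ℝ) =
      (Uᵀ.map (MvPolynomial.C : ℝ →+* MvPolynomial (Fin 2) ℝ))ᵀ *
        ((MvPolynomial.X (1 : Fin 2) : MvPolynomial (Fin 2) ℝ) •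
              (Matrix.fromBlocks 1 0 0 0 : Matrix (Fin r ⊕ Fin s) (Fin r ⊕ Fin s) ℝ).map
                (MvPolynomial.C : ℝ →+* MvPolynomial (Fin 2) ℝ)) *
        Uᵀ.map (MvPolynomial.C : ℝ →+* MvPolynomial (Fin 2) ℝ) := by
    conv_lhs => rw [hPc]
    rw [Matrix.map_mul, Matrix.map_mul, Matrix.transpose_map, Matrix.mul_smul, Matrix.smul_mul]
  have hdetU : (Uᵀ.map (MvPolynomial.C : ℝ →+* MvPolynomial (Fin 2) ℝ)).det ^ 2 = 1 := by
    rw [← RingHom.mapMatrix_apply, ← RingHom.map_det, ← map_pow, Matrix.det_transpose]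
    have h1 := congrArg Matrix.det hU
    rw [Matrix.det_mul, Matrix.det_transpose, Matrix.det_one] at h1
    rw [sq, h1, map_one]
  conv_lhs => rw [hsum, hproj, ← Matrix.add_mul, ← Matrix.mul_add]
  rw [Matrix.det_mul, Matrix.det_mul, Matrix.det_transpose]
  calc _ = (Uᵀ.map (MvPolynomial.C : ℝ →+* MvPolynomial (Fin 2) ℝ)).det ^ 2 * (∑ l, (MvPolynomial.X (0 : Fin 2) : MvPolynomial (Fin 2) ℝ) ^ d l •
              (D l).map (MvPolynomial.C : ℝ →+* MvPolynomial (Fin 2) ℝ)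
            + (MvPolynomial.X (1 : Fin 2) : MvPolynomial (Fin 2) ℝ) •
              (Matrix.fromBlocks 1 0 0 0 : Matrix (Fin r ⊕ Fin s) (Fin r ⊕ Fin s) ℝ).map
                (MvPolynomial.C : ℝ →+* MvPolynomial (Fin 2) ℝ)).det := by ring
    _ = _ := by rw [hdetU, one_mul]

/-! ### The law at every splitting -/

set_option maxHeartbeats 800000 in
/-- **COMMUTING-PENCIL OSCULATION LAW, every splitting.**  The body of the line's `OsculationLawAt m K (m·K² + m²·K)`
(unfolded verbatim) with TWO hypotheses inserted after the symmetry hypothesis: the letters commute pairwise AND with the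
inserted letter `I_r ⊕ 0`.  Restricted class; NOT the LAW `stub_osculationLaw`. -/
theorem osculationLawAt_commuting (m K : ℕ) :
    ∀ (r s : ℕ), r + s = m → ∀ (d : Fin K → ℕ) (S : Fin K → Matrix (Fin r ⊕ Fin s) (Fin r ⊕ Fin s) ℝ),
      (∀ l, (S l).IsSymm) → (∀ l l', Commute (S l) (S l')) →
      (∀ l, Commute (S l) (Matrix.fromBlocks 1 0 0 0 : Matrix (Fin r ⊕ Fin s) (Fin r ⊕ Fin s) ℝ)) →
      {p : Fin 2 → ℝ | 0 < p 0 ∧ 0 < p 1 ∧ MvPolynomial.eval p (∑ l, (MvPolynomial.X (0 : Fin 2) : MvPolynomial (Fin 2) ℝ) ^ d l •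
              (S l).map (MvPolynomial.C : ℝ →+* MvPolynomial (Fin 2) ℝ)
            + (MvPolynomial.X (1 : Fin 2) : MvPolynomial (Fin 2) ℝ) •
              (Matrix.fromBlocks 1 0 0 0 : Matrix (Fin r ⊕ Fin s) (Fin r ⊕ Fin s) ℝ).map
                (MvPolynomial.C : ℝ →+* MvPolynomial (Fin 2) ℝ)).det = 0 ∧
      MvPolynomial.eval p
        (MvPolynomial.X 0 * MvPolynomial.pderiv 0 (MvPolynomial.X 0 * MvPolynomial.pderiv 0 ((∑ l, (MvPolynomial.X (0 : Fin 2) : MvPolynomial (Fin 2) ℝ) ^ d l •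
              (S l).map (MvPolynomial.C : ℝ →+* MvPolynomial (Fin 2) ℝ)
            + (MvPolynomial.X (1 : Fin 2) : MvPolynomial (Fin 2) ℝ) •
              (Matrix.fromBlocks 1 0 0 0 : Matrix (Fin r ⊕ Fin s) (Fin r ⊕ Fin s) ℝ).map
                (MvPolynomial.C : ℝ →+* MvPolynomial (Fin 2) ℝ)).det)) * (MvPolynomial.X 1 * MvPolynomial.pderiv 1 ((∑ l, (MvPolynomial.X (0 : Fin 2) : MvPolynomial (Fin 2) ℝ) ^ d l •
              (S l).map (MvPolynomial.C : ℝ →+* MvPolynomial (Fin 2) ℝ)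
            + (MvPolynomial.X (1 : Fin 2) : MvPolynomial (Fin 2) ℝ) •
              (Matrix.fromBlocks 1 0 0 0 : Matrix (Fin r ⊕ Fin s) (Fin r ⊕ Fin s) ℝ).map
                (MvPolynomial.C : ℝ →+* MvPolynomial (Fin 2) ℝ)).det)) ^ 2
          - 2 * (MvPolynomial.X 0 * MvPolynomial.pderiv 0 (MvPolynomial.X 1 * MvPolynomial.pderiv 1 ((∑ l, (MvPolynomial.X (0 : Fin 2) : MvPolynomial (Fin 2) ℝ) ^ d l •
              (S l).map (MvPolynomial.C : ℝ →+* MvPolynomial (Fin 2) ℝ)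
            + (MvPolynomial.X (1 : Fin 2) : MvPolynomial (Fin 2) ℝ) •
              (Matrix.fromBlocks 1 0 0 0 : Matrix (Fin r ⊕ Fin s) (Fin r ⊕ Fin s) ℝ).map
                (MvPolynomial.C : ℝ →+* MvPolynomial (Fin 2) ℝ)).det)))
            * (MvPolynomial.X 0 * MvPolynomial.pderiv 0 ((∑ l, (MvPolynomial.X (0 : Fin 2) : MvPolynomial (Fin 2) ℝ) ^ d l •
              (S l).map (MvPolynomial.C : ℝ →+* MvPolynomial (Fin 2) ℝ)
            + (MvPolynomial.X (1 : Fin 2) : MvPolynomial (Fin 2) ℝ) •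
              (Matrix.fromBlocks 1 0 0 0 : Matrix (Fin r ⊕ Fin s) (Fin r ⊕ Fin s) ℝ).map
                (MvPolynomial.C : ℝ →+* MvPolynomial (Fin 2) ℝ)).det)) * (MvPolynomial.X 1 * MvPolynomial.pderiv 1 ((∑ l, (MvPolynomial.X (0 : Fin 2) : MvPolynomial (Fin 2) ℝ) ^ d l •
              (S l).map (MvPolynomial.C : ℝ →+* MvPolynomial (Fin 2) ℝ)
            + (MvPolynomial.X (1 : Fin 2) : MvPolynomial (Fin 2) ℝ) •
              (Matrix.fromBlocks 1 0 0 0 : Matrix (Fin r ⊕ Fin s) (Fin r ⊕ Fin s) ℝ).map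
                (MvPolynomial.C : ℝ →+* MvPolynomial (Fin 2) ℝ)).det))
          + MvPolynomial.X 1 * MvPolynomial.pderiv 1 (MvPolynomial.X 1 * MvPolynomial.pderiv 1 ((∑ l, (MvPolynomial.X (0 : Fin 2) : MvPolynomial (Fin 2) ℝ) ^ d l •
              (S l).map (MvPolynomial.C : ℝ →+* MvPolynomial (Fin 2) ℝ)
            + (MvPolynomial.X (1 : Fin 2) : MvPolynomial (Fin 2) ℝ) •
              (Matrix.fromBlocks 1 0 0 0 : Matrix (Fin r ⊕ Fin s) (Fin r ⊕ Fin s) ℝ).map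
                (MvPolynomial.C : ℝ →+* MvPolynomial (Fin 2) ℝ)).det)) * (MvPolynomial.X 0 * MvPolynomial.pderiv 0 ((∑ l, (MvPolynomial.X (0 : Fin 2) : MvPolynomial (Fin 2) ℝ) ^ d l •
              (S l).map (MvPolynomial.C : ℝ →+* MvPolynomial (Fin 2) ℝ)
            + (MvPolynomial.X (1 : Fin 2) : MvPolynomial (Fin 2) ℝ) •
              (Matrix.fromBlocks 1 0 0 0 : Matrix (Fin r ⊕ Fin s) (Fin r ⊕ Fin s) ℝ).map
                (MvPolynomial.C : ℝ →+* MvPolynomial (Fin 2) ℝ)).det)) ^ 2) = 0}.Finite →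
      {p : Fin 2 → ℝ | 0 < p 0 ∧ 0 < p 1 ∧ MvPolynomial.eval p (∑ l, (MvPolynomial.X (0 : Fin 2) : MvPolynomial (Fin 2) ℝ) ^ d l •
              (S l).map (MvPolynomial.C : ℝ →+* MvPolynomial (Fin 2) ℝ)
            + (MvPolynomial.X (1 : Fin 2) : MvPolynomial (Fin 2) ℝ) •
              (Matrix.fromBlocks 1 0 0 0 : Matrix (Fin r ⊕ Fin s) (Fin r ⊕ Fin s) ℝ).map
                (MvPolynomial.C : ℝ →+* MvPolynomial (Fin 2) ℝ)).det = 0 ∧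
      MvPolynomial.eval p
        (MvPolynomial.X 0 * MvPolynomial.pderiv 0 (MvPolynomial.X 0 * MvPolynomial.pderiv 0 ((∑ l, (MvPolynomial.X (0 : Fin 2) : MvPolynomial (Fin 2) ℝ) ^ d l •
              (S l).map (MvPolynomial.C : ℝ →+* MvPolynomial (Fin 2) ℝ)
            + (MvPolynomial.X (1 : Fin 2) : MvPolynomial (Fin 2) ℝ) •
              (Matrix.fromBlocks 1 0 0 0 : Matrix (Fin r ⊕ Fin s) (Fin r ⊕ Fin s) ℝ).map
                (MvPolynomial.C : ℝ →+* MvPolynomial (Fin 2) ℝ)).det)) * (MvPolynomial.X 1 * MvPolynomial.pderiv 1 ((∑ l, (MvPolynomial.X (0 : Fin 2) : MvPolynomial (Fin 2) ℝ) ^ d l •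
              (S l).map (MvPolynomial.C : ℝ →+* MvPolynomial (Fin 2) ℝ)
            + (MvPolynomial.X (1 : Fin 2) : MvPolynomial (Fin 2) ℝ) •
              (Matrix.fromBlocks 1 0 0 0 : Matrix (Fin r ⊕ Fin s) (Fin r ⊕ Fin s) ℝ).map
                (MvPolynomial.C : ℝ →+* MvPolynomial (Fin 2) ℝ)).det)) ^ 2
          - 2 * (MvPolynomial.X 0 * MvPolynomial.pderiv 0 (MvPolynomial.X 1 * MvPolynomial.pderiv 1 ((∑ l, (MvPolynomial.X (0 : Fin 2) : MvPolynomial (Fin 2) ℝ) ^ d l •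
              (S l).map (MvPolynomial.C : ℝ →+* MvPolynomial (Fin 2) ℝ)
            + (MvPolynomial.X (1 : Fin 2) : MvPolynomial (Fin 2) ℝ) •
              (Matrix.fromBlocks 1 0 0 0 : Matrix (Fin r ⊕ Fin s) (Fin r ⊕ Fin s) ℝ).map
                (MvPolynomial.C : ℝ →+* MvPolynomial (Fin 2) ℝ)).det)))
            * (MvPolynomial.X 0 * MvPolynomial.pderiv 0 ((∑ l, (MvPolynomial.X (0 : Fin 2) : MvPolynomial (Fin 2) ℝ) ^ d l •
              (S l).map (MvPolynomial.C : ℝ →+* MvPolynomial (Fin 2) ℝ)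
            + (MvPolynomial.X (1 : Fin 2) : MvPolynomial (Fin 2) ℝ) •
              (Matrix.fromBlocks 1 0 0 0 : Matrix (Fin r ⊕ Fin s) (Fin r ⊕ Fin s) ℝ).map
                (MvPolynomial.C : ℝ →+* MvPolynomial (Fin 2) ℝ)).det)) * (MvPolynomial.X 1 * MvPolynomial.pderiv 1 ((∑ l, (MvPolynomial.X (0 : Fin 2) : MvPolynomial (Fin 2) ℝ) ^ d l •
              (S l).map (MvPolynomial.C : ℝ →+* MvPolynomial (Fin 2) ℝ)
            + (MvPolynomial.X (1 : Fin 2) : MvPolynomial (Fin 2) ℝ) •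
              (Matrix.fromBlocks 1 0 0 0 : Matrix (Fin r ⊕ Fin s) (Fin r ⊕ Fin s) ℝ).map
                (MvPolynomial.C : ℝ →+* MvPolynomial (Fin 2) ℝ)).det))
          + MvPolynomial.X 1 * MvPolynomial.pderiv 1 (MvPolynomial.X 1 * MvPolynomial.pderiv 1 ((∑ l, (MvPolynomial.X (0 : Fin 2) : MvPolynomial (Fin 2) ℝ) ^ d l •
              (S l).map (MvPolynomial.C : ℝ →+* MvPolynomial (Fin 2) ℝ)
            + (MvPolynomial.X (1 : Fin 2) : MvPolynomial (Fin 2) ℝ) •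
              (Matrix.fromBlocks 1 0 0 0 : Matrix (Fin r ⊕ Fin s) (Fin r ⊕ Fin s) ℝ).map
                (MvPolynomial.C : ℝ →+* MvPolynomial (Fin 2) ℝ)).det)) * (MvPolynomial.X 0 * MvPolynomial.pderiv 0 ((∑ l, (MvPolynomial.X (0 : Fin 2) : MvPolynomial (Fin 2) ℝ) ^ d l •
              (S l).map (MvPolynomial.C : ℝ →+* MvPolynomial (Fin 2) ℝ)
            + (MvPolynomial.X (1 : Fin 2) : MvPolynomial (Fin 2) ℝ) •
              (Matrix.fromBlocks 1 0 0 0 : Matrix (Fin r ⊕ Fin s) (Fin r ⊕ Fin s) ℝ).map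
                (MvPolynomial.C : ℝ →+* MvPolynomial (Fin 2) ℝ)).det)) ^ 2) = 0}.ncard ≤ m * K ^ 2 + m ^ 2 * K := by
  intro r s hrs d S hS hC hP hfin
  obtain ⟨U, hU, hU', hUP, hdiag⟩ := exists_orthogonal_proj_forall_isDiag S hS (fun k l => (hC k l).eq) hP
  set D : Fin K → Matrix (Fin r ⊕ Fin s) (Fin r ⊕ Fin s) ℝ := fun l => Uᵀ * S l * U with hDdef
  have hpoly : (∑ l, (MvPolynomial.X (0 : Fin 2) : MvPolynomial (Fin 2) ℝ) ^ d l •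
              (S l).map (MvPolynomial.C : ℝ →+* MvPolynomial (Fin 2) ℝ)
            + (MvPolynomial.X (1 : Fin 2) : MvPolynomial (Fin 2) ℝ) •
              (Matrix.fromBlocks 1 0 0 0 : Matrix (Fin r ⊕ Fin s) (Fin r ⊕ Fin s) ℝ).map
                (MvPolynomial.C : ℝ →+* MvPolynomial (Fin 2) ℝ)).det = (∑ l, (MvPolynomial.X (0 : Fin 2) : MvPolynomial (Fin 2) ℝ) ^ d l •
              (D l).map (MvPolynomial.C : ℝ →+* MvPolynomial (Fin 2) ℝ)
            + (MvPolynomial.X (1 : Fin 2) : MvPolynomial (Fin 2) ℝ) •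
              (Matrix.fromBlocks 1 0 0 0 : Matrix (Fin r ⊕ Fin s) (Fin r ⊕ Fin s) ℝ).map
                (MvPolynomial.C : ℝ →+* MvPolynomial (Fin 2) ℝ)).det :=
    det_pencil_congr_orthogonal d S D U hU hU' hUP (fun l => rfl)
  rw [hpoly] at hfin ⊢
  exact osc_diagonal_le m K r s hrs d D (fun l => hdiag l) hfin

end OsculationCommuting

end Summit.ValiantsHypothesis.ValiantsHypothesis.Theorems.LacunarySymmetroidMatrixDescartes

end
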